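import Mathlib
import HarnessLib
import Summits.Ventures.LatticeQCDFlow.Scaling.TorusRankedMorseCount

/-!
# LatticeQCDFlow / Scaling — the fraction of plaquettes of `(ℤ/L)^d` that must ride on the Metropolis
# step of an exact one-plaquette heat-bath autoregression tends to `(d−2)/d`

HONEST FRAMING: exact (Metropolis-corrected) sampling algorithms for lattice gauge theory;
figures of merit are autocorrelation/cost numbers at stated couplings and volumes; no
continuum-physics claim.

Venture `LatticeQCDFlow` (cell pub-lqcd), topic `Scaling`, FANOUT row 30 (lean-1, GEN-25) — OUR WORK on
THEORY-2.md §4 row C5.  `TorusRankedMorseCount.isLeast_card_compl_ranked`: the least number of plaquettes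
outside a ranked structure of `(ℤ/L)^d` is `k_min(d, L) = (d−1)(d−2)/2·L^d + (d−1)`, of
`#plaquettes = d(d−1)/2·L^d`.  Here the ratio, as the volume grows:

* `two_mul_card_plaquette_eq` — `2·#plaquettes = d(d−1)·L^d`; `kmin_formula_real` — the real form
  `k_min = ((d−1)(d−2)/2)·L^d + (d−1)` with an honest division;
* **`tendsto_kmin_div_card_plaquette`** — for `d ≥ 2`,
  `k_min(d, L)/#plaquettes(d, L) → (d−2)/d` as `L → ∞`: NONE of the plaquettes in two dimensions (one
  plaquette), A THIRD in three, A HALF in four, and the fraction `2/(d·L^d)` above the limit at finite `L`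
  (**`kmin_div_card_plaquette_eq`**: the ratio is EXACTLY `(d−2)/d + 2/(d·L^d)`).

No `def`, no `sorry`, nothing cited as a fact beyond the tree.
-/

namespace Summit.Ventures.LatticeQCDFlow.Theory2.Autoregressive

open Finset Filter Topology
open Literature.MathematicalPhysics.QuantumFieldTheory

variable {d : ℕ}

/-- `2·#plaquettes = d(d−1)·L^d` on `(ℤ/L)^d`. [folklore] -/
theorem two_mul_card_plaquette_eq (d L : ℕ) [NeZero L] :
    2 * Fintype.card (Plaquette d L) = d * (d - 1) * L ^ d := by
  have h := two_mul_card_plaquette d L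
  rw [Summit.Ventures.LatticeQCDFlow.Runbook.card_site] at h
  rw [h]; ring

/-- The real form of `k_min`: `((d−1)(d−2)/2 : ℕ)·L^d + (d−1) = ((d−1)(d−2)/2 : ℝ)·L^d + (d−1)` (the natural
division is exact). [ours] -/
theorem kmin_formula_real (d L : ℕ) :
    (((d - 1) * (d - 2) / 2 * L ^ d + (d - 1) : ℕ) : ℝ) =
      ((d - 1 : ℕ) : ℝ) * ((d - 2 : ℕ) : ℝ) / 2 * (L : ℝ) ^ d + ((d - 1 : ℕ) : ℝ) := by
  have hE := two_mul_choose_coeff d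
  have hEr : (((d - 1) * (d - 2) / 2 : ℕ) : ℝ) = ((d - 1 : ℕ) : ℝ) * ((d - 2 : ℕ) : ℝ) / 2 := by
    have : (2 : ℝ) * (((d - 1) * (d - 2) / 2 : ℕ) : ℝ) = ((d - 1 : ℕ) : ℝ) * ((d - 2 : ℕ) : ℝ) := by
      exact_mod_cast hE
    linarith
  push_cast
  rw [hEr]

/-- **The ratio is exactly `(d−2)/d + 2/(d·L^d)`** (`d ≥ 2`, `L ≥ 1`). [ours] -/
theorem kmin_div_card_plaquette_eq (hd : 2 ≤ d) {L : ℕ} [NeZero L] (hL : 1 ≤ L) :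
    (((d - 1) * (d - 2) / 2 * L ^ d + (d - 1) : ℕ) : ℝ) / (Fintype.card (Plaquette d L) : ℝ) =
      ((d : ℝ) - 2) / d + 2 / ((d : ℝ) * (L : ℝ) ^ d) := by
  have hP := two_mul_card_plaquette_eq d L
  have hPr : (Fintype.card (Plaquette d L) : ℝ) = (d : ℝ) * ((d : ℝ) - 1) / 2 * (L : ℝ) ^ d := by
    have h2 : (2 : ℝ) * (Fintype.card (Plaquette d L) : ℝ) = (d : ℝ) * ((d - 1 : ℕ) : ℝ) * (L : ℝ) ^ d := by
      exact_mod_cast hP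
    have h1 : ((d - 1 : ℕ) : ℝ) = (d : ℝ) - 1 := by
      rw [Nat.cast_sub (by omega)]; simp
    rw [h1] at h2
    linarith
  rw [kmin_formula_real, hPr]
  have h1 : ((d - 1 : ℕ) : ℝ) = (d : ℝ) - 1 := by rw [Nat.cast_sub (by omega)]; simp
  have h2 : ((d - 2 : ℕ) : ℝ) = (d : ℝ) - 2 := by rw [Nat.cast_sub hd]; simp
  rw [h1, h2]
  have hd0 : (0 : ℝ) < d := by exact_mod_cast (show 0 < d by omega)
  have hd1 : (0 : ℝ) < (d : ℝ) - 1 := by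
    have : (2 : ℝ) ≤ d := by exact_mod_cast hd
    linarith
  have hLd : (0 : ℝ) < (L : ℝ) ^ d := pow_pos (by exact_mod_cast hL) _
  field_simp

/-- **`k_min(d, L)/#plaquettes(d, L) → (d−2)/d` as `L → ∞`** (`d ≥ 2`): asymptotically none of the
plaquettes in `d = 2`, a third in `d = 3`, a half in `d = 4`, `(d−2)/d` in general must stay outside every
exact one-plaquette heat-bath autoregression of `(ℤ/L)^d` — and, by the Morse structure, no more.
(`#plaquettes` is written `d(d−1)/2·L^d`, its value by `two_mul_card_plaquette_eq`.) [ours] -/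
theorem tendsto_kmin_div_card_plaquette (hd : 2 ≤ d) :
    Tendsto (fun L : ℕ => (((d - 1) * (d - 2) / 2 * L ^ d + (d - 1) : ℕ) : ℝ) /
        ((d : ℝ) * ((d : ℝ) - 1) / 2 * (L : ℝ) ^ d)) atTop (𝓝 (((d : ℝ) - 2) / d)) := by
  have hd0 : (0 : ℝ) < d := by exact_mod_cast (show 0 < d by omega)
  have hd1 : (0 : ℝ) < (d : ℝ) - 1 := by
    have : (2 : ℝ) ≤ d := by exact_mod_cast hd
    linarith
  have h1 : ((d - 1 : ℕ) : ℝ) = (d : ℝ) - 1 := by rw [Nat.cast_sub (by omega)]; simp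
  have h2 : ((d - 2 : ℕ) : ℝ) = (d : ℝ) - 2 := by rw [Nat.cast_sub hd]; simp
  -- eventually (for `L ≥ 1`) the ratio is `(d−2)/d + 2/(d·L^d)`
  have hev : ∀ᶠ L : ℕ in atTop, (((d - 1) * (d - 2) / 2 * L ^ d + (d - 1) : ℕ) : ℝ) /
      ((d : ℝ) * ((d : ℝ) - 1) / 2 * (L : ℝ) ^ d) = ((d : ℝ) - 2) / d + 2 / ((d : ℝ) * (L : ℝ) ^ d) := by
    filter_upwards [eventually_ge_atTop 1] with L hL
    rw [kmin_formula_real, h1, h2]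
    have hLd : (0 : ℝ) < (L : ℝ) ^ d := pow_pos (by exact_mod_cast hL) _
    field_simp
  rw [tendsto_congr' hev]
  have hlim : Tendsto (fun L : ℕ => 2 / ((d : ℝ) * (L : ℝ) ^ d)) atTop (𝓝 0) := by
    have hpow : Tendsto (fun L : ℕ => (d : ℝ) * (L : ℝ) ^ d) atTop atTop := by
      refine Tendsto.const_mul_atTop hd0 ?_
      have : Tendsto (fun L : ℕ => ((L ^ d : ℕ) : ℝ)) atTop atTop :=
        tendsto_natCast_atTop_atTop.comp (tendsto_pow_atTop (by omega))
      refine this.congr fun L => ?_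
      push_cast; rfl
    exact tendsto_const_nhds.div_atTop hpow
  simpa using tendsto_const_nhds.add hlim

end Summit.Ventures.LatticeQCDFlow.Theory2.Autoregressive
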